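import Literature.NumberTheory.Rogawski1990.ArchTransfFamily                  -- ★ (TRANSF-DEF) (LH7-p02 (g2)): `slotPerm`, `partnerPerms`, `partnerWeight` (+ atlases `endoTorus`, `gprimeTorus`)
import Literature.NumberTheory.Rogawski1990.ArchEndoscopicCentralCurveGSide   -- ★ `transferFactor_delta_out_mk` (the (W1) relabel-kit pattern)
import HarnessLib

/-!
# The transfer side read on the charts: `Σᶠ_{[γ′]} Δ(γ_H, γ′) Φ([γ′])` as the weighted partner sum `w_S · Σ_{ρ ∈ partnerPerms S}` (R2 of O-READ; Rogawski 1990 §4.3 (4.3.1),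
# §14.3; Shelstad 1979 Lemma 4.2)

Topic `NumberTheory/Rogawski1990`; namespace `Literature.NumberTheory.Rogawski1990`.  THEOREMS ONLY (no `def`, no instance, no notation, no axiom, no named fact, no
`sorry`).  Cell `pub/hodgecm-mathlib`, crux H413 (`stmt-HodgeConjecture-24833`), F0∕P3c line LH3, DIRECT ROAD of `stub_N9`; seat LH3-p03 (g2); brick **R2 `ArchTransferSideChartSum`**
of LH3-plan (g2)'s N9 «Transf» board (DEALER WORDS 06:28:37Z (3): «the finsum over `ConjClasses G′_∞` of `Δ(γ_H, out c′)·Φ(c′)` at `γ_H = endoTorus S c`, `c ∈ RegG S`, equals the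
`partnerWeight`-weighted `Σ_{ρ ∈ partnerPerms S}`-form given P1+P2+P3 — the algebraic half of O-READ; hypotheses P2∕P3 BY STATEMENT until ★»).  Count-neutral.

THE MATHEMATICS.  Print's transfer side at `γ_H` is `Σ_{[γ′] ↔ γ_H} Δ(γ_H, γ′) Φ([γ′], a′)` ((4.3.1), §14.3) — in the tree the `finsum` over `ConjClasses G′_∞` of
`Δ(γ_H, out c′) · Φ(c′)`, the factor `Δ` (★ `TransferFactorData`: supported on norm pairs, a class function in each variable) killing the non-partners.  On the charts (★ atlases):
for `γ_H = endoTorus S c` the candidate partners are `gprimeTorus S (slotPerm ρ c)`, `ρ ∈ partnerPerms S` (★ `ArchTransfFamily`).  Two hypotheses, BY STATEMENT (they are the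
theorems (PARTNER) P2 = (EXH-G′) + P1, resp. P3, of the atlas, being landed by LH7-p01 (g2) ∕ LH4-p03 (g4)):
* **(hP2) EXHAUSTION OF THE PARTNER CLASSES**: every class `c′` with `γ_H → out c′` is `⟦gprimeTorus S (slotPerm ρ c)⟧` for some `ρ ∈ partnerPerms S`;
* **(hP3) CONSTANT FIBRES**: for `ρ ∈ partnerPerms S`, the number of `ρ′ ∈ partnerPerms S` with `⟦gprimeTorus S (slotPerm ρ′ c)⟧ = ⟦gprimeTorus S (slotPerm ρ c)⟧` is `w_S⁻¹`
  (`w_S = partnerWeight L α S = ∏_{w ∉ S} (2 or 6)⁻¹`).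
Then, by the RELABEL KIT (`finsum` over the finite image, summed over fibres — ★ pattern `finsum_delta_mul_integral_eq_sum_relabel`, here abstracted once as
`finsum_eq_sum_card_fiber_inv_mul` ∕ `finsum_eq_inv_mul_sum_of_card_fiber_eq`):
**`Σᶠ_{c′} Δ(γ_H, out c′) Φ(c′) = w_S · Σ_{ρ ∈ partnerPerms S} Δ(γ_H, gprimeTorus S (slotPerm ρ c)) · Φ(⟦gprimeTorus S (slotPerm ρ c)⟧)`**
(`finsum_delta_mul_eq_partnerWeight_mul_sum`), for EVERY `Δ : ArchTransferFactor` and every `Φ : ConjClasses G′_∞ → ℂ` — the shape O-READ (R0, LH4-p02 (g3)) consumes with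
`Φ = classOrbitalIntegral m′ a′` and `Δ = archExplicitTransferFactor`.  The unweighted version with the literal fibre cardinalities (`finsum_delta_mul_eq_sum_card_fiber_inv_mul`)
needs (hP2) alone.
* §1 generic: `finsum_eq_sum_card_fiber_inv_mul`, `finsum_eq_inv_mul_sum_of_card_fiber_eq`;
* §2 `support_delta_mul_subset_image_partnerPerms`, **`finsum_delta_mul_eq_sum_card_fiber_inv_mul`**, **`finsum_delta_mul_eq_partnerWeight_mul_sum`**.
HONEST LABEL: HC_CM is proved only modulo the 7 printed citations (2 remaining: hLiu418 = `stmt-HodgeConjecture-24832`, h413 = `stmt-HodgeConjecture-24833`) until rung 0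
closes; bookkeeping, count-neutral (+0∕+0).

## References
* [Rogawski1990] J. D. Rogawski, *Automorphic Representations of Unitary Groups in Three Variables*, Ann. of Math. Stud. 123 (1990), §4.3 (4.3.1) p. 43 (the transfer sum over the
  classes `{γ′} ↔ γ_H`), §14.3 pp. 233–234, §3.8 pp. 30–32 (the classes within a stable class).
* [Shelstad1979] D. Shelstad, *Characters and inner forms of a quasi-split group over ℝ*, Compositio Math. 39 (1979), Lemma 4.2 p. 23 (the partner points on the Cartan charts).
-/

set_option autoImplicit false

noncomputable section

open NumberField NumberField.InfinitePlace Matrix Complex Finset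
open scoped MatrixGroups Matrix Classical
open Literature.NumberTheory.Automorphic Literature.NumberTheory.Automorphic.UnitaryGroup Literature.NumberTheory.Automorphic.ArchCartan

namespace Literature.NumberTheory.Rogawski1990

/-! ## §1 The relabel kit, abstract: a `finsum` supported on a finite image is a fibre-weighted sum -/

section Relabel

variable {ι X : Type*} [DecidableEq X] {M : Type*} [Field M] [CharZero M]

/-- **A `finsum` supported on the image of a finite index set is the fibre-weighted sum over the indices**: `Σᶠ_x g x = Σ_{i ∈ s} #{j ∈ s ∣ f j = f i}⁻¹ · g (f i)`.
[cite: Rogawski1990, §4.3 (4.3.1) p. 43; §3.8 pp. 30–32] -/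
theorem finsum_eq_sum_card_fiber_inv_mul (s : Finset ι) (f : ι → X) (g : X → M) (hsupp : Function.support g ⊆ ↑(s.image f)) :
    ∑ᶠ x, g x = ∑ i ∈ s, ((s.filter fun j => f j = f i).card : M)⁻¹ * g (f i) := by
  rw [finsum_eq_finsetSum_of_support_subset g hsupp]
  refine Finset.sum_image' _ fun i hi => ?_
  have hconst : ∀ j ∈ s.filter (fun j => f j = f i), ((s.filter fun j' => f j' = f j).card : M)⁻¹ * g (f j) = ((s.filter fun j' => f j' = f i).card : M)⁻¹ * g (f i) := by
    intro j hj
    rw [(Finset.mem_filter.1 hj).2]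
  rw [Finset.sum_congr rfl hconst, Finset.sum_const, nsmul_eq_mul, ← mul_assoc, mul_inv_cancel₀, one_mul]
  exact Nat.cast_ne_zero.2 (Finset.card_ne_zero.2 ⟨i, Finset.mem_filter.2 ⟨hi, rfl⟩⟩)

/-- **Constant fibres**: if every fibre of `f` on `s` has `N` elements, `Σᶠ_x g x = N⁻¹ · Σ_{i ∈ s} g (f i)`. [cite: Rogawski1990, §4.3 (4.3.1) p. 43; §3.8 pp. 30–32] -/
theorem finsum_eq_inv_mul_sum_of_card_fiber_eq (s : Finset ι) (f : ι → X) (g : X → M) (hsupp : Function.support g ⊆ ↑(s.image f)) (N : M)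
    (hN : ∀ i ∈ s, ((s.filter fun j => f j = f i).card : M)⁻¹ = N) :
    ∑ᶠ x, g x = N * ∑ i ∈ s, g (f i) := by
  rw [finsum_eq_sum_card_fiber_inv_mul s f g hsupp, Finset.mul_sum]
  exact Finset.sum_congr rfl fun i hi => by rw [hN i hi]

end Relabel

/-! ## §2 The transfer side on the Cartan charts -/

section ChartSum

variable (L : Type) [Field L] [NumberField L] [IsCMField L] (α : Fin 3 → L)
  (T : ArchTransferFactor L (Matrix.diagonal α))
  (Φ : ConjClasses ↥(UnitaryGroup.arch (↥(maximalRealSubfield L)) L (IsCMField.complexConj L) 3 (Matrix.diagonal α)) → ℂ)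
  (S : Finset {w : InfinitePlace L // IsComplex w}) (c : {w : InfinitePlace L // IsComplex w} → Fin 3 → ℝ)

/-- **(hP2) puts the support of `c′ ↦ Δ(γ_H, out c′) Φ(c′)` inside the finite set of partner classes** (`Δ` vanishes off the norm pairs, ★ `TransferFactorData.eq_zero_of_not_rel`).
[cite: Rogawski1990, §4.3 (4.3.1) p. 43; §14.3 p. 234] -/
theorem support_delta_mul_subset_image_partnerPerms
    (hP2 : ∀ c' : ConjClasses ↥(UnitaryGroup.arch (↥(maximalRealSubfield L)) L (IsCMField.complexConj L) 3 (Matrix.diagonal α)),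
      IsArchNormPair L (Matrix.diagonal α) (endoTorus L S c) (Quotient.out c') →
        ∃ ρ ∈ partnerPerms S, c' = ConjClasses.mk (gprimeTorus L α S (slotPerm ρ c))) :
    (Function.support fun c' : ConjClasses ↥(UnitaryGroup.arch (↥(maximalRealSubfield L)) L (IsCMField.complexConj L) 3 (Matrix.diagonal α)) =>
        T.Δ (endoTorus L S c) (Quotient.out c') * Φ c') ⊆
      ↑((partnerPerms S).image fun ρ => ConjClasses.mk (gprimeTorus L α S (slotPerm ρ c))) := by
  intro c' hc'
  rw [Function.mem_support] at hc'
  have hΔ : T.Δ (endoTorus L S c) (Quotient.out c') ≠ 0 := fun h => hc' (by rw [h, zero_mul])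
  have hrel : IsArchNormPair L (Matrix.diagonal α) (endoTorus L S c) (Quotient.out c') := by
    by_contra h; exact hΔ (T.eq_zero_of_not_rel _ _ h)
  obtain ⟨ρ, hρ, hc'ρ⟩ := hP2 c' hrel
  exact Finset.mem_coe.2 (Finset.mem_image.2 ⟨ρ, hρ, hc'ρ.symm⟩)

/-- **THE TRANSFER SIDE ON THE CHARTS, LITERAL FIBRE COUNTS** (needs (hP2) only): `Σᶠ_{c′} Δ(γ_H, out c′) Φ(c′) = Σ_{ρ ∈ partnerPerms S} n_ρ⁻¹ · Δ(γ_H, gprimeTorus S (ρ·c)) ·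
Φ(⟦gprimeTorus S (ρ·c)⟧)`, `n_ρ = #{ρ′ ∈ partnerPerms S ∣ ⟦gprimeTorus S (ρ′·c)⟧ = ⟦gprimeTorus S (ρ·c)⟧}`, `γ_H = endoTorus S c`. [cite: Rogawski1990, §4.3 (4.3.1) p. 43; §14.3 pp. 233–234]
[cite: Shelstad1979, Lemma 4.2 (p. 23)] -/
theorem finsum_delta_mul_eq_sum_card_fiber_inv_mul
    (hP2 : ∀ c' : ConjClasses ↥(UnitaryGroup.arch (↥(maximalRealSubfield L)) L (IsCMField.complexConj L) 3 (Matrix.diagonal α)),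
      IsArchNormPair L (Matrix.diagonal α) (endoTorus L S c) (Quotient.out c') →
        ∃ ρ ∈ partnerPerms S, c' = ConjClasses.mk (gprimeTorus L α S (slotPerm ρ c))) :
    ∑ᶠ c' : ConjClasses ↥(UnitaryGroup.arch (↥(maximalRealSubfield L)) L (IsCMField.complexConj L) 3 (Matrix.diagonal α)),
        T.Δ (endoTorus L S c) (Quotient.out c') * Φ c' =
      ∑ ρ ∈ partnerPerms S,
        (((partnerPerms S).filter fun ρ' => ConjClasses.mk (gprimeTorus L α S (slotPerm ρ' c)) = ConjClasses.mk (gprimeTorus L α S (slotPerm ρ c))).card : ℂ)⁻¹ *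
          (T.Δ (endoTorus L S c) (gprimeTorus L α S (slotPerm ρ c)) * Φ (ConjClasses.mk (gprimeTorus L α S (slotPerm ρ c)))) := by
  have h := finsum_eq_sum_card_fiber_inv_mul (M := ℂ) (partnerPerms S) (fun ρ => ConjClasses.mk (gprimeTorus L α S (slotPerm ρ c)))
    (fun c' => T.Δ (endoTorus L S c) (Quotient.out c') * Φ c') (support_delta_mul_subset_image_partnerPerms L α T Φ S c hP2)
  refine h.trans (Finset.sum_congr rfl fun ρ _ => ?_)
  simp only [transferFactor_delta_out_mk]

set_option maxHeartbeats 400000 in -- (ops: the `simp`/`finsum` elaboration of this head sits at the 200k cliff on the farm; statement unchanged)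
/-- **THE TRANSFER SIDE ON THE CHARTS, WEIGHTED FORM** ((hP2) exhaustion + (hP3) constant fibres `= w_S⁻¹`):
`Σᶠ_{c′} Δ(γ_H, out c′) Φ(c′) = w_S · Σ_{ρ ∈ partnerPerms S} Δ(γ_H, gprimeTorus S (ρ·c)) · Φ(⟦gprimeTorus S (ρ·c)⟧)`, `γ_H = endoTorus S c`, `w_S = partnerWeight L α S` — the shape
O-READ consumes (`Φ = classOrbitalIntegral m′ a′`, `Δ = archExplicitTransferFactor`). [cite: Rogawski1990, §4.3 (4.3.1) p. 43; §14.3 pp. 233–234] [cite: Shelstad1979, Lemma 4.2 (p. 23)] -/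
theorem finsum_delta_mul_eq_partnerWeight_mul_sum
    (hP2 : ∀ c' : ConjClasses ↥(UnitaryGroup.arch (↥(maximalRealSubfield L)) L (IsCMField.complexConj L) 3 (Matrix.diagonal α)),
      IsArchNormPair L (Matrix.diagonal α) (endoTorus L S c) (Quotient.out c') →
        ∃ ρ ∈ partnerPerms S, c' = ConjClasses.mk (gprimeTorus L α S (slotPerm ρ c)))
    (hP3 : ∀ ρ ∈ partnerPerms S,
      (((partnerPerms S).filter fun ρ' => ConjClasses.mk (gprimeTorus L α S (slotPerm ρ' c)) = ConjClasses.mk (gprimeTorus L α S (slotPerm ρ c))).card : ℂ)⁻¹ =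
        partnerWeight L α S) :
    ∑ᶠ c' : ConjClasses ↥(UnitaryGroup.arch (↥(maximalRealSubfield L)) L (IsCMField.complexConj L) 3 (Matrix.diagonal α)),
        T.Δ (endoTorus L S c) (Quotient.out c') * Φ c' =
      partnerWeight L α S * ∑ ρ ∈ partnerPerms S, T.Δ (endoTorus L S c) (gprimeTorus L α S (slotPerm ρ c)) * Φ (ConjClasses.mk (gprimeTorus L α S (slotPerm ρ c))) := by
  have h := finsum_eq_inv_mul_sum_of_card_fiber_eq (M := ℂ) (partnerPerms S) (fun ρ => ConjClasses.mk (gprimeTorus L α S (slotPerm ρ c)))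
    (fun c' => T.Δ (endoTorus L S c) (Quotient.out c') * Φ c') (support_delta_mul_subset_image_partnerPerms L α T Φ S c hP2) (partnerWeight L α S) hP3
  refine h.trans ?_
  congr 1
  refine Finset.sum_congr rfl fun ρ _ => ?_
  simp only [transferFactor_delta_out_mk]

end ChartSum

end Literature.NumberTheory.Rogawski1990

end
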